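import Mathlib
import HarnessLib
import Summits.CriticalPhenomena.Ising3DConformalLimit.Theses.PlantedPinning
import Summits.CriticalPhenomena.Ising3DConformalLimit.Theorems.PlantedPinningPinningEfficiencyDeficitOfSlack

/-!
# Strategist sketch s9 — crux `PinningEfficiencyDeficit` (stmt-CriticalPhenomena-8451)

Companion to `STRATEGY-CENSUS-s9.md` (independent census, family `-s`).  Contents:

* §1 the WEAKER INTERMEDIATE: the infinitely-often form `PinningEfficiencyDeficitIO` (literally the
  negation of the conclusion of `GaussianPinningSaturation`), with `io_of_deficit` (it is weaker),
  `io_iff_not_saturationConclusion` (it is the weakest statement the present glue can use) and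
  `closes_of_io` (the route's deciding theorem goes through UNCHANGED with it);
* §2 short spellings of the planted pinning flow (`pvar`, `csq`, `spatial`, `eff`) that are
  definitionally the route's let-tower (`deficit_iff`, `deficit_of_csSlackWindow'`);
* §3 the STRENGTHENING `SpatialSlackWindow` (S⁺: the spatial term of `csq − pvar²` alone carries the
  slack) and the typed DECOMPOSITION attempt `LocalisedCov ∧ LocalValueDependence` — signatures only;
  the census explains why neither is filed (piece `LocalValueDependence` is the whole crux).

Nothing here is proposed to the tree; it elaborates against the route file and the landed
`PlantedPinningPinningEfficiencyDeficitOfSlack`.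
-/

namespace Summit.CriticalPhenomena.Ising3DConformalLimit.Cruxes.PinningEfficiencyDeficit.S9

open Literature.Probability.LatticeModels
open Summit.CriticalPhenomena.Ising3DConformalLimit.Theses.PlantedPinning
open scoped BigOperators
open Finset

noncomputable section

/-! ## §1 The weaker intermediate (IO form) -/

/-- **IO form of the deficit** — same let-tower as the route item, conclusion weakened from
"eventually in p, eventually in L" to "for p arbitrarily small, for L arbitrarily large":
`∃ ε > 0, ∀ p₀ > 0, ∃ p ∈ (0,p₀), ∀ L₀, ∃ L ≥ L₀, e_L(⌈p·n⌉) ≤ 1 − ε`. -/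
def PinningEfficiencyDeficitIO : Prop :=
  let βc : ℝ := Literature.Probability.LatticeModels.criticalBeta 3; let M : ℕ → Literature.Probability.LatticeModels.SpinConfig (Literature.Probability.LatticeModels.Site 3) → ℝ := fun L σ => ∑ x ∈ Literature.Probability.LatticeModels.box 3 L, Literature.Probability.LatticeModels.spinAt x σ; let cvar : ℕ → Finset (Literature.Probability.LatticeModels.Site 3) → Literature.Probability.LatticeModels.SpinConfig (Literature.Probability.LatticeModels.Site 3) → ℝ := fun L P η => Literature.Probability.LatticeModels.isingExpect (Literature.Probability.LatticeModels.zdGraph 3) (Literature.Probability.LatticeModels.box 3 L \ P) βc 0 (.fixed η) (fun σ => M L σ ^ 2) - Literature.Probability.LatticeModels.isingExpect (Literature.Probability.LatticeModels.zdGraph 3) (Literature.Probability.LatticeModels.box 3 L \ P) βc 0 (.fixed η) (M L) ^ 2; let pvar : ℕ → ℕ → ℝ := fun L k => (∑ P ∈ (Literature.Probability.LatticeModels.box 3 L).powersetCard k, ∑ τ : ↥(Literature.Probability.LatticeModels.box 3 L) → ℤˣ, Literature.Probability.LatticeModels.isingWeight (Literature.Probability.LatticeModels.zdGraph 3) (Literature.Probability.LatticeModels.box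 3 L) βc 0 .plus τ / Literature.Probability.LatticeModels.isingPartitionFunction (Literature.Probability.LatticeModels.zdGraph 3) (Literature.Probability.LatticeModels.box 3 L) βc 0 .plus * cvar L P (Literature.Probability.LatticeModels.glue (Literature.Probability.LatticeModels.box 3 L) τ .plus)) / ((Literature.Probability.LatticeModels.box 3 L).card.choose k : ℝ); let eff : ℕ → ℕ → ℝ := fun L k => (k : ℝ) * pvar L k / ((((Literature.Probability.LatticeModels.box 3 L).card : ℝ) + 1) * (((Literature.Probability.LatticeModels.box 3 L).card : ℝ) - k + 1)); ∃ ε : ℝ, 0 < ε ∧ ∀ p₀ : ℝ, 0 < p₀ → ∃ p : ℝ, 0 < p ∧ p < p₀ ∧ ∀ L₀ : ℕ, ∃ L ≥ L₀, eff L ⌈p * ((Literature.Probability.LatticeModels.box 3 L).card : ℝ)⌉₊ ≤ 1 - ε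

/-- **The conclusion of `GaussianPinningSaturation`** (`e → 1` along `L → ∞` then `p → 0`),
as a free-standing proposition with the same let-tower. -/
def SaturationConclusion : Prop :=
  let βc : ℝ := Literature.Probability.LatticeModels.criticalBeta 3; let M : ℕ → Literature.Probability.LatticeModels.SpinConfig (Literature.Probability.LatticeModels.Site 3) → ℝ := fun L σ => ∑ x ∈ Literature.Probability.LatticeModels.box 3 L, Literature.Probability.LatticeModels.spinAt x σ; let cvar : ℕ → Finset (Literature.Probability.LatticeModels.Site 3) → Literature.Probability.LatticeModels.SpinConfig (Literature.Probability.LatticeModels.Site 3) → ℝ := fun L P η => Literature.Probability.LatticeModels.isingExpect (Literature.Probability.LatticeModels.zdGraph 3) (Literature.Probability.LatticeModels.box 3 L \ P) βc 0 (.fixed η) (fun σ => M L σ ^ 2) - Literature.Probability.LatticeModels.isingExpect (Literature.Probability.LatticeModels.zdGraph 3) (Literature.Probability.LatticeModels.box 3 L \ P) βc 0 (.fixed η) (M L) ^ 2; let pvar : ℕ → ℕ → ℝ := fun L k => (∑ P ∈ (Literature.Probability.LatticeModels.box 3 L).powersetCard k, ∑ τ : ↥(Literature.Probability.LatticeModels.box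 3 L) → ℤˣ, Literature.Probability.LatticeModels.isingWeight (Literature.Probability.LatticeModels.zdGraph 3) (Literature.Probability.LatticeModels.box 3 L) βc 0 .plus τ / Literature.Probability.LatticeModels.isingPartitionFunction (Literature.Probability.LatticeModels.zdGraph 3) (Literature.Probability.LatticeModels.box 3 L) βc 0 .plus * cvar L P (Literature.Probability.LatticeModels.glue (Literature.Probability.LatticeModels.box 3 L) τ .plus)) / ((Literature.Probability.LatticeModels.box 3 L).card.choose k : ℝ); let eff : ℕ → ℕ → ℝ := fun L k => (k : ℝ) * pvar L k / ((((Literature.Probability.LatticeModels.box 3 L).card : ℝ) + 1) * (((Literature.Probability.LatticeModels.box 3 L).card : ℝ) - k + 1)); ∀ ε : ℝ, 0 < ε → ∃ p₀ : ℝ, 0 < p₀ ∧ ∀ p : ℝ, 0 < p → p < p₀ → ∃ L₀ : ℕ, ∀ L ≥ L₀, 1 - ε ≤ eff L ⌈p * ((Literature.Probability.LatticeModels.box 3 L).card : ℝ)⌉₊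

/-- The route item implies its IO form (the IO form is weaker). -/
theorem io_of_deficit : PinningEfficiencyDeficit → PinningEfficiencyDeficitIO := by
  rintro ⟨ε, hε, p₀, hp₀, h⟩
  refine ⟨ε, hε, fun p₁ hp₁ => ?_⟩
  have hmin : 0 < min p₀ p₁ := lt_min hp₀ hp₁
  have hle₀ : min p₀ p₁ ≤ p₀ := min_le_left p₀ p₁
  have hle₁ : min p₀ p₁ ≤ p₁ := min_le_right p₀ p₁
  obtain ⟨L₁, hL₁⟩ := h (min p₀ p₁ / 2) (by linarith) (by linarith)
  exact ⟨min p₀ p₁ / 2, by linarith, by linarith,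
    fun L₀ => ⟨max L₀ L₁, le_max_left _ _, hL₁ _ (le_max_right _ _)⟩⟩

/-- The IO form is EXACTLY the negation of the saturation conclusion: it is the weakest statement
the present deciding theorem can consume in place of the deficit. -/
theorem io_iff_not_saturationConclusion :
    PinningEfficiencyDeficitIO ↔ ¬ SaturationConclusion := by
  constructor
  · rintro ⟨ε, hε, hio⟩ hsat
    obtain ⟨p₀, hp₀, hs⟩ := hsat (ε / 2) (by linarith)
    obtain ⟨p, hp, hpp₀, hL⟩ := hio p₀ hp₀
    obtain ⟨L₀, hL₀⟩ := hs p hp hpp₀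
    obtain ⟨L, hLL₀, hdef⟩ := hL L₀
    have h₁ := hL₀ L hLL₀
    linarith
  · intro hns
    by_contra hnio
    apply hns
    intro ε hε
    by_contra hcon
    apply hnio
    refine ⟨ε, hε, fun p₀ hp₀ => ?_⟩
    by_contra hcon'
    apply hcon
    refine ⟨p₀, hp₀, fun p hp hpp₀ => ?_⟩
    by_contra hcon''
    apply hcon'
    refine ⟨p, hp, hpp₀, fun L₀ => ?_⟩
    by_contra hcon'''
    apply hcon''
    refine ⟨L₀, fun L hL => ?_⟩
    by_contra hlt
    apply hcon'''
    exact ⟨L, hL, (not_le.mp hlt).le⟩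

/-- **The deciding theorem goes through unchanged with the IO form** (same proof shape as the
route's `closes`): IO-deficit → Gaussian ⇒ saturation → Möbius limit exists → summit conjunct. -/
theorem closes_of_io : PinningEfficiencyDeficitIO → GaussianPinningSaturation → MoebiusLimitExists →
    _root_.Ising3DConformalLimit := by
  intro hIO hSat hMoeb
  obtain ⟨ρ, Δ, S, hρ, hΔ, hlim, hnd, hmob⟩ := hMoeb
  refine ⟨ρ, Δ, S, hρ, hΔ, hlim, hnd, hmob, ?_⟩
  by_contra hU4
  obtain ⟨ε, hε, hio⟩ := hIO
  obtain ⟨p₁, hp₁, hsat⟩ := hSat ρ Δ S hρ hΔ hlim hnd hmob hU4 (ε / 2) (by linarith)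
  obtain ⟨p, hp, hpp₁, hL⟩ := hio p₁ hp₁
  obtain ⟨L₁, hL₁⟩ := hsat p hp hpp₁
  obtain ⟨L, hLL₁, hdef⟩ := hL L₁
  have h₁ := hL₁ L hLL₁
  linarith

/-- Conversely the route item is NOT recoverable from the IO form by logic alone: the IO form is
consistent with `e_L(⌈pn⌉) → 1` along a subsequence of `p → 0` (no claim about limits existing). We
only record the trivial direction `Deficit → IO`; the census argues the analytic substance is equal. -/
example : PinningEfficiencyDeficit → PinningEfficiencyDeficitIO := io_of_deficit

/-! ## §2 Short spellings of the planted pinning flow (definitionally the route's let-tower) -/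

/-- `n = |box 3 L|`. -/
abbrev nL (L : ℕ) : ℕ := (box 3 L).card
/-- `β_c(3)`. -/
abbrev βc : ℝ := criticalBeta 3
/-- total magnetisation of the box. -/
abbrev Mag (L : ℕ) (σ : SpinConfig (Site 3)) : ℝ := ∑ x ∈ box 3 L, spinAt x σ
/-- planted weight of the pattern `τ` (`μ⁺_{Λ_L;β_c,0}`). -/
abbrev wt (L : ℕ) (τ : ↥(box 3 L) → ℤˣ) : ℝ :=
  isingWeight (zdGraph 3) (box 3 L) βc 0 .plus τ / isingPartitionFunction (zdGraph 3) (box 3 L) βc 0 .plus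
/-- conditional expectation given the pins `P` carry the planted pattern `τ`. -/
abbrev cE (L : ℕ) (P : Finset (Site 3)) (τ : ↥(box 3 L) → ℤˣ) (f : SpinConfig (Site 3) → ℝ) : ℝ :=
  isingExpect (zdGraph 3) (box 3 L \ P) βc 0 (.fixed (glue (box 3 L) τ .plus)) f
/-- conditional variance of `M` given the pins. -/
abbrev cvar (L : ℕ) (P : Finset (Site 3)) (τ : ↥(box 3 L) → ℤˣ) : ℝ :=
  cE L P τ (fun σ => Mag L σ ^ 2) - cE L P τ (Mag L) ^ 2
/-- local conditional susceptibility `C_z = Cov(M, σ_z | pins)`. -/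
abbrev Cz (L : ℕ) (P : Finset (Site 3)) (τ : ↥(box 3 L) → ℤˣ) (z : Site 3) : ℝ :=
  cE L P τ (fun σ => Mag L σ * spinAt z σ) - cE L P τ (Mag L) * cE L P τ (fun σ => spinAt z σ)
/-- planted conditional variance averaged over `k`-subsets and patterns. -/
abbrev pvar (L k : ℕ) : ℝ :=
  (∑ P ∈ (box 3 L).powersetCard k, ∑ τ : ↥(box 3 L) → ℤˣ, wt L τ * cvar L P τ) / ((nL L).choose k : ℝ)
/-- the Cauchy–Schwarz majorant `(n−j)·Σ_z C_z²`, averaged. -/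
abbrev csq (L j : ℕ) : ℝ :=
  (∑ P ∈ (box 3 L).powersetCard j, ∑ τ : ↥(box 3 L) → ℤˣ, wt L τ *
      (((nL L : ℝ) - j) * ∑ z ∈ box 3 L \ P, Cz L P τ z ^ 2)) / ((nL L).choose j : ℝ)
/-- the SPATIAL term of `csq − pvar²`: `(n−j)·Σ_z (C_z − X/(n−j))²`, averaged. -/
abbrev spatial (L j : ℕ) : ℝ :=
  (∑ P ∈ (box 3 L).powersetCard j, ∑ τ : ↥(box 3 L) → ℤˣ, wt L τ *
      (((nL L : ℝ) - j) * ∑ z ∈ box 3 L \ P, (Cz L P τ z - cvar L P τ / ((nL L : ℝ) - j)) ^ 2)) /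
    ((nL L).choose j : ℝ)
/-- pinning efficiency `e_L(k)`. -/
abbrev eff (L k : ℕ) : ℝ := (k : ℝ) * pvar L k / (((nL L : ℝ) + 1) * ((nL L : ℝ) - k + 1))
/-- `k(p) = ⌈p·n⌉`. -/
abbrev kp (p : ℝ) (L : ℕ) : ℕ := ⌈p * (nL L : ℝ)⌉₊

/-- The route item, unfolded into the short spellings (definitional). -/
theorem deficit_iff : PinningEfficiencyDeficit ↔
    ∃ ε : ℝ, 0 < ε ∧ ∃ p₀ : ℝ, 0 < p₀ ∧ ∀ p : ℝ, 0 < p → p < p₀ →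
      ∃ L₀ : ℕ, ∀ L ≥ L₀, eff L (kp p L) ≤ 1 - ε := Iff.rfl

/-- The registered stub S1 (`stub_csSlackWindow`) in the short spellings. -/
def CsSlackWindow : Prop :=
  ∃ s : ℝ, 0 < s ∧ ∃ p₀ : ℝ, 0 < p₀ ∧ ∀ p : ℝ, 0 < p → p < p₀ → ∃ L₀ : ℕ, ∀ L ≥ L₀, ∀ j : ℕ,
    kp p L ≤ 2 * j → j < kp p L → (1 + s) * pvar L j ^ 2 ≤ csq L j

/-- Check that the short spelling of S1 is definitionally the hypothesis of the landed composition
`pinningEfficiencyDeficit_of_csSlackWindow` (so everything below is about the REGISTERED stub). -/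
theorem deficit_of_csSlackWindow' : CsSlackWindow → PinningEfficiencyDeficit :=
  fun h => PlantedPinningDeficit.pinningEfficiencyDeficit_of_csSlackWindow h

/-! ## §3 Strengthening and decomposition attempts (signatures only) -/

/-- **S⁺ (strengthen): the spatial term alone carries the slack.**  By the landed exact
decomposition `csq − pvar² = spatial + pattern + pin-set` (`PlantedPinningDeficit.csq_sub_pvar_sq_eq`,
`spatial_le_csq_sub_pvar_sq`) this implies S1 after the same Ising instantiation as `pvar_sq_le_csq`
(routine, M-sized); the census argues the two dropped terms are `O(L*(p)³/n) → 0`, so S⁺ has the same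
analytic content as S1: a `p`-uniform lower bound on the RELATIVE SPATIAL VARIANCE of `z ↦ C_z`. -/
def SpatialSlackWindow : Prop :=
  ∃ s : ℝ, 0 < s ∧ ∃ p₀ : ℝ, 0 < p₀ ∧ ∀ p : ℝ, 0 < p → p < p₀ → ∃ L₀ : ℕ, ∀ L ≥ L₀, ∀ j : ℕ,
    kp p L ≤ 2 * j → j < kp p L → s * pvar L j ^ 2 ≤ spatial L j

/-- The reduction S⁺ → S1 as a proposition (provable now from `spatial_le_csq_sub_pvar_sq`; not
proved here because the Ising instantiation is ~100 lines and the census does not file the line). -/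
def SpatialReduction : Prop := SpatialSlackWindow → CsSlackWindow

/-- The `R`-ball around `z` inside the box (sup norm). -/
abbrev ballIn (L : ℕ) (z : Site 3) (R : ℕ) : Finset (Site 3) :=
  (box 3 L).filter fun x => Site.supNorm (x - z) ≤ R

/-- Localised conditional susceptibility: condition additionally on ALL planted spins outside the
`R`-ball of `z` (boundary condition = the planted configuration itself), keep the pins inside. -/
abbrev CzLoc (L : ℕ) (P : Finset (Site 3)) (τ : ↥(box 3 L) → ℤˣ) (z : Site 3) (R : ℕ) : ℝ :=
  let E : (SpinConfig (Site 3) → ℝ) → ℝ := fun f =>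
    isingExpect (zdGraph 3) (ballIn L z R \ P) βc 0 (.fixed (glue (box 3 L) τ .plus)) f
  let Mloc : SpinConfig (Site 3) → ℝ := fun σ => ∑ x ∈ ballIn L z R, spinAt x σ
  E (fun σ => Mloc σ * spinAt z σ) - E Mloc * E (fun σ => spinAt z σ)

/-- **Decomposition piece D₁ (locking / screening scale): `C_z` is local at a `p`-dependent scale.**
For every accuracy `δ` there is a radius `R(p, δ)` (expected `≍ L*(p) = p^{-1/(3−2Δ_σ)}` up to
`log(1/δ)`) such that replacing `C_z` by its `R`-localisation costs at most `δ·` (mean square of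
`C_z`), uniformly in `L`. Two-sided screening by the planted pins; plausible, open, L-sized at least
(needs a planted analogue of exponential decay beyond the pinning correlation length). -/
def LocalisedCov : Prop :=
  ∀ δ : ℝ, 0 < δ → ∃ p₀ : ℝ, 0 < p₀ ∧ ∀ p : ℝ, 0 < p → p < p₀ → ∃ R : ℕ, ∃ L₀ : ℕ, ∀ L ≥ L₀,
    ∀ j : ℕ, kp p L ≤ 2 * j → j < kp p L →
      (∑ P ∈ (box 3 L).powersetCard j, ∑ τ : ↥(box 3 L) → ℤˣ, wt L τ *
          ∑ z ∈ box 3 L \ P, (Cz L P τ z - CzLoc L P τ z R) ^ 2) ≤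
        δ * ∑ P ∈ (box 3 L).powersetCard j, ∑ τ : ↥(box 3 L) → ℤˣ, wt L τ *
          ∑ z ∈ box 3 L \ P, Cz L P τ z ^ 2

/-- **Decomposition piece D₂ (value dependence at the screening scale): the localised
susceptibilities are NOT spatially constant** — their spatial variance is a `p`-uniform fraction of
their mean square, at every radius beyond some `R₀(p)`.  This is where non-Gaussianity of the
critical state enters (for the massless GFF `CzLoc` does not depend on the planted VALUES and its
spatial relative variance → 0 as `p → 0`); the census identifies D₂ with the whole crux. -/
def LocalValueDependence : Prop :=
  ∃ s : ℝ, 0 < s ∧ ∃ p₀ : ℝ, 0 < p₀ ∧ ∀ p : ℝ, 0 < p → p < p₀ → ∃ R₀ : ℕ, ∀ R ≥ R₀, ∃ L₀ : ℕ,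
    ∀ L ≥ L₀, ∀ j : ℕ, kp p L ≤ 2 * j → j < kp p L →
      s * (∑ P ∈ (box 3 L).powersetCard j, ∑ τ : ↥(box 3 L) → ℤˣ, wt L τ *
          ∑ z ∈ box 3 L \ P, CzLoc L P τ z R ^ 2) ≤
        ∑ P ∈ (box 3 L).powersetCard j, ∑ τ : ↥(box 3 L) → ℤˣ, wt L τ *
          (((nL L : ℝ) - j) * ∑ z ∈ box 3 L \ P,
            (CzLoc L P τ z R - (∑ y ∈ box 3 L \ P, CzLoc L P τ y R) / ((nL L : ℝ) - j)) ^ 2) /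
          ((nL L : ℝ) - j)

/-- The decomposition's assembly as a proposition: D₁ ∧ D₂ → S⁺ (an `ℓ²` triangle inequality plus
`Σ_z C_z² ≥ pvar²/(n−j)`-type bookkeeping; provable in principle, M/L-sized).  NOT filed: D₂ is the
crux again (census §Decomposition). -/
def DecompositionAssembly : Prop := LocalisedCov → LocalValueDependence → SpatialSlackWindow

/-! ## §4 What IS provable now, and why it carries no summit information

The fixed-`p` deficit: `ε` may depend on `p`.  Provable-now sketch (census §Weaker intermediate):
an unpinned site whose `2d = 6` neighbours are all pinned is conditionally independent of the rest,
so its `C_z = Var(σ_z | pins) = 1 − tanh²(β_c Σ τ) ∈ [1 − tanh²(6β_c), 1]`, while on the window the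
mean `X/(n−j)` is either `≤ 4` at some step (then `e_L(k) ≤ 4p/(1−p) + o(1)` by antitonicity of
`pvar`) or `≥ 4` throughout (then the `≍ p⁶·(n−j)` isolated sites give `spatial_j ≥ c·p⁶·pvar_j²`,
i.e. S1 with `s = c·p⁶`, and the landed Riccati-with-slack step applies).  The SAME argument works
for the massless lattice GFF, where nevertheless `e(p) → 1`: every slack that present tools certify
is an ultraviolet lattice effect of relative size `p^a → 0`; the crux asks for slack that survives
`p → 0`, i.e. lives at the screening scale `L*(p) → ∞`. -/

/-- **Fixed-`p` deficit** (`ε = ε(p)`): strictly weaker than the route item, does NOT feed `closes`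
(compatible with `GaussianPinningSaturation`'s conclusion), holds for the GFF benchmark as well. -/
def PinningEfficiencyDeficitPointwise : Prop :=
  ∃ p₀ : ℝ, 0 < p₀ ∧ ∀ p : ℝ, 0 < p → p < p₀ → ∃ ε : ℝ, 0 < ε ∧
    ∃ L₀ : ℕ, ∀ L ≥ L₀, eff L (kp p L) ≤ 1 - ε

/-- Its place in the ladder: `Deficit → Pointwise` (trivial); the converse is the whole difficulty
(uniformity of `ε` as `p → 0`). -/
theorem pointwise_of_deficit : PinningEfficiencyDeficit → PinningEfficiencyDeficitPointwise := by
  rintro ⟨ε, hε, p₀, hp₀, h⟩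
  exact ⟨p₀, hp₀, fun p hp hpp₀ => ⟨ε, hε, h p hp hpp₀⟩⟩

/-- The isolated-site slack that proves the pointwise form (signature; `c·p⁶` is the density of
unpinned sites with all six neighbours pinned, up to the window factor `2⁻⁶`). -/
def IsolatedSiteSlack : Prop :=
  ∃ c : ℝ, 0 < c ∧ ∃ p₀ : ℝ, 0 < p₀ ∧ ∀ p : ℝ, 0 < p → p < p₀ → ∃ L₀ : ℕ, ∀ L ≥ L₀, ∀ j : ℕ,
    kp p L ≤ 2 * j → j < kp p L → 4 * (nL L : ℝ) ≤ pvar L j →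
      (1 + c * p ^ 6) * pvar L j ^ 2 ≤ csq L j

end

end Summit.CriticalPhenomena.Ising3DConformalLimit.Cruxes.PinningEfficiencyDeficit.S9
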